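import Summits.ValiantsHypothesis.ValiantsHypothesis.Theses.RealTau
import Literature.Computability.AlgebraicComplexity.RealTauKnownCases

/-!
# `RealTau.RealTauRefined` (stmt-ValiantsHypothesis-18101) — negative side, II: the line `fischer-powers`
# redirects the crux without leakage (its open stub is the crux)

Refuter (cdisprove cycle 1, 2026-08-17), from `Cruxes/RealTauRefined/Disproof.lean` Part II §(i).
Line `fischer-powers` (`Cruxes/RealTauRefined/Lines/fischer_powers.lean`; strategist's skeleton, lead's
reshapes r1 sha 0284ba295063 and r2): `stub_waringOnCurve` (r1) / `stub_waringLargeK` (r2, `K ≥ 3`) is the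
open core, `stub_commonSupport` and `stub_fischer` (and r2's `stub_waringSmallK`) are true.  Certified here,
all with the SAME exponent `a` as the crux:

* `equalPowerSigned_of_realTauRefined` — the crux implies the antecedent of `stub_fischer`
  (`EqualPowerSigned`): a signed sum of `K` `m`-th powers of `T`-sparse polynomials is a `(K, m, T)`
  ΣΠ-sparse expression (sign on the first factor; `m = 0` is a constant);
* `waringOnCurve_of_realTauRefined` — hence the open stub WITHOUT its `StrictMono e` hypothesis
  (so `StrictMono` is cosmetic), `stub_waringOnCurve_of_realTauRefined` (r1 verbatim) and
  `stub_waringLargeK_of_realTauRefined` (r2 verbatim).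
So the open stub is EQUIVALENT to the crux given the line's provable stubs: the line is a normal-form
redirect, a kill of the stub is a kill of the crux, and conversely nothing leaks. [folklore]
-/

set_option linter.dupNamespace false

namespace Summit.ValiantsHypothesis.ValiantsHypothesis.Theorems.RealTauRefined.Negative

open Polynomial Finset
open Literature.Computability.AlgebraicComplexity
open Summit.ValiantsHypothesis.ValiantsHypothesis.Theses.RealTau

/-- A sum of `T` monomials has at most `T` monomials. [folklore] -/
theorem card_support_sum_monomials_le (T : ℕ) (a : Fin T → ℝ) (e : Fin T → ℕ) :
    (∑ l : Fin T, C (a l) * X ^ (e l)).support.card ≤ T := by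
  have h1 := card_support_sum_le (univ : Finset (Fin T)) (fun l => C (a l) * X ^ (e l))
  have h2 : ∑ l : Fin T, (C (a l) * X ^ (e l)).support.card ≤ ∑ _l : Fin T, (1 : ℕ) :=
    Finset.sum_le_sum fun l _ => card_support_C_mul_X_pow_le_one
  rw [Finset.sum_const, Finset.card_univ, Fintype.card_fin, smul_eq_mul, mul_one] at h2
  exact h1.trans h2

/-! ### line `fischer-powers`: the open stub is the crux -/

/-- LINE `fischer-powers`: the crux implies the antecedent of `stub_fischer` (`EqualPowerSigned`)
with the SAME exponent — a signed sum of `K` `m`-th powers of `T`-sparse polynomials is a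
`(K, m, T)` ΣΠ-sparse expression (put the sign on the first factor). [folklore] -/
theorem equalPowerSigned_of_realTauRefined (hR : RealTauRefined) :
    ∃ a : ℕ, ∀ (K m T : ℕ) (ε : Fin K → ℤˣ) (h : Fin K → Polynomial ℝ),
      (∀ i, (h i).support.card ≤ T) →
        (∑ i, C (((ε i : ℤ) : ℝ)) * h i ^ m) ≠ 0 →
          (∑ i, C (((ε i : ℤ) : ℝ)) * h i ^ m).roots.toFinset.card
            ≤ 2 ^ (a * (m + 1)) * (K + T + 2) ^ a := by
  obtain ⟨a, ha⟩ := hR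
  refine ⟨a, fun K m T ε h hh hne => ?_⟩
  rcases Nat.eq_zero_or_pos m with rfl | hm
  · have h0 : (∑ i, C (((ε i : ℤ) : ℝ)) * h i ^ 0) = C (∑ i, (((ε i : ℤ) : ℝ))) := by
      simp [map_sum]
    rw [h0, roots_C]
    simp
  · obtain ⟨n, rfl⟩ : ∃ n, m = n + 1 := ⟨m - 1, by omega⟩
    let f : Fin K → Fin (n + 1) → ℝ[X] := fun i => Fin.cons (C (((ε i : ℤ) : ℝ)) * h i) (fun _ => h i)
    have hprod : ∀ i, (∏ j, f i j) = C (((ε i : ℤ) : ℝ)) * h i ^ (n + 1) := by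
      intro i
      rw [Fin.prod_univ_succ]
      simp only [f, Fin.cons_zero, Fin.cons_succ, Finset.prod_const, Finset.card_univ,
        Fintype.card_fin]
      ring
    have hsum : (∑ i, ∏ j, f i j) = ∑ i, C (((ε i : ℤ) : ℝ)) * h i ^ (n + 1) :=
      Finset.sum_congr rfl fun i _ => hprod i
    have hfs : ∀ i j, (f i j).support.card ≤ T := by
      intro i j
      refine Fin.cases ?_ (fun j => ?_) j
      · simp only [f, Fin.cons_zero]
        rw [C_mul']
        exact (card_le_card (support_smul _ _)).trans (hh i)
      · simp only [f, Fin.cons_succ]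
        exact hh i
    have := ha K (n + 1) T f hfs (by rw [hsum]; exact hne)
    rwa [hsum] at this

/-- LINE `fischer-powers`: the crux implies the open stub `stub_waringOnCurve` verbatim (and even
without its `StrictMono e` hypothesis, which is therefore cosmetic) — with the line's two true
stubs, stub 1 is EQUIVALENT to the crux: the line is a normal-form redirect, not a reduction. [folklore] -/
theorem waringOnCurve_of_realTauRefined (hR : RealTauRefined) :
    ∃ a : ℕ, ∀ (K m T : ℕ) (ε : Fin K → ℤˣ) (c : Fin K → Fin T → ℝ) (e : Fin T → ℕ),
      (∑ i, C (((ε i : ℤ) : ℝ)) * (∑ l, C (c i l) * X ^ (e l)) ^ m) ≠ 0 →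
        (∑ i, C (((ε i : ℤ) : ℝ)) * (∑ l, C (c i l) * X ^ (e l)) ^ m).roots.toFinset.card
          ≤ 2 ^ (a * (m + 1)) * (K + T + 2) ^ a := by
  obtain ⟨a, ha⟩ := equalPowerSigned_of_realTauRefined hR
  exact ⟨a, fun K m T ε c e hne =>
    ha K m T ε (fun i => ∑ l, C (c i l) * X ^ (e l)) (fun i => card_support_sum_monomials_le T (c i) e) hne⟩

/-- The registered stub statement (with `StrictMono e`) follows. [folklore] -/
theorem stub_waringOnCurve_of_realTauRefined (hR : RealTauRefined) :
    ∃ a : ℕ, ∀ (K m T : ℕ) (ε : Fin K → ℤˣ) (c : Fin K → Fin T → ℝ) (e : Fin T → ℕ), StrictMono e →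
      (∑ i, C (((ε i : ℤ) : ℝ)) * (∑ l, C (c i l) * X ^ (e l)) ^ m) ≠ 0 →
        (∑ i, C (((ε i : ℤ) : ℝ)) * (∑ l, C (c i l) * X ^ (e l)) ^ m).roots.toFinset.card
          ≤ 2 ^ (a * (m + 1)) * (K + T + 2) ^ a := by
  obtain ⟨a, ha⟩ := waringOnCurve_of_realTauRefined hR
  exact ⟨a, fun K m T ε c e _ hne => ha K m T ε c e hne⟩

/-- Lead's reshape r2 (2026-08-17, `Lines/fischer_powers.lean`): the open core is now `stub_waringLargeK`
(`K ≥ 3`); the crux implies it verbatim as well (drop the hypotheses `3 ≤ K` and `StrictMono e`), so the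
r2 open stub is again EQUIVALENT to the crux given the line's true stubs 1a, 2, 3. [folklore] -/
theorem stub_waringLargeK_of_realTauRefined (hR : RealTauRefined) :
    ∃ a : ℕ, ∀ (K m T : ℕ) (ε : Fin K → ℤˣ) (c : Fin K → Fin T → ℝ) (e : Fin T → ℕ), 3 ≤ K →
      StrictMono e →
      (∑ i, C (((ε i : ℤ) : ℝ)) * (∑ l, C (c i l) * X ^ (e l)) ^ m) ≠ 0 →
        (∑ i, C (((ε i : ℤ) : ℝ)) * (∑ l, C (c i l) * X ^ (e l)) ^ m).roots.toFinset.card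
          ≤ 2 ^ (a * (m + 1)) * (K + T + 2) ^ a := by
  obtain ⟨a, ha⟩ := waringOnCurve_of_realTauRefined hR
  exact ⟨a, fun K m T ε c e _ _ hne => ha K m T ε c e hne⟩

end Summit.ValiantsHypothesis.ValiantsHypothesis.Theorems.RealTauRefined.Negative
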